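import Summits.QuantumFields.YangMills.Theorems.BalabanUVNodesN07PointFeasibilityOneLevelRobustBridge
import Summits.QuantumFields.YangMills.Theorems.BalabanUVNodesN07AliasSumRobustBound
import HarnessLib

/-!
# DAG node N07 [B11], road R0′ ∕ (L4) road v1 socket (S2-x) — THE ROBUST ONE-LEVEL INEQUALITY (R1L) IN x-SPACE, UNCONDITIONAL (odd `n ≥ 3`):
# `|⟨β, S_{c₀}Δ⁻²r − Q′Δ⁻²r⟩| ≤ √C(d,n) · ‖Δ⁻¹Q′ᴴβ‖ · ‖r‖`, `C(d,n) = (π²∕4)^d(π⁴∕1024 + d²π⁴n^d∕64)` — dag-n07-w7 g6's display `aliasSum_robust_bound` (p637570)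
# re-indexed to the momentum grid and fed to `…OneLevelRobustBridge.robustBound_of_gridDisplay`

Cell `pub-ymgap` (HUMAN RULINGS D-0062 ∕ D-0149 ∕ D-0154), width seat `pub-ymgap-dag-n07-w5` g3, CLAIM-3 ∕ INTENT-3 cell bus 2026-08-28 (OFFER of dag-n07-w7 g6, I.38186),
FILE 4 = the discharge half (split off `…OneLevelRobustBridge` for the 400-line rule).  `--kind proof --supports stmt-QuantumFields-27364 --as helper` (K1⁹ per dag-lead KEY MAP v2;
count-neutral).  THEOREMS ONLY.

THE PRINT.  [B5] = `[Balaban1984PropagatorsI]` CMP **95** (1984) 17–40: (1.29)–(1.33) p. 23 (`p = p′ + l`, the alias sums); [B6] = `[Balaban1984PropagatorsII]` CMP **96** (1984)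
223–250: (2.22) p. 226; [I] = `[Balaban1987RG1]` CMP **109** (1987) 249–301: (0.4) p. 253 (the centre averaging, odd `L`).

WHAT THIS FILE DOES (namespace `Summit.QuantumFields.YangMills.BalabanUVNodes.N07PointFeasibilityOneLevelRobustBridge`, continued).
* `sum_reindex_neg` — re-indexing the signed representatives `s ∈ [−π,π]^J` to `θ_ν := if s_ν < 0 then s_ν + 2π else s_ν ∈ [0,2π)` for a GENERAL summand
  `Ψ(Π_κ F_κ, Σ_κ G_κ)` (g2's `sum_reindex_gen` had the other sign convention, which sends `s_ν = 0` to `2π`; here `s_ν = 0 ↦ θ_ν = 0`, where dag-n07-w7's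
  `F(0,m) = δ_{m,0}` is this lineage's `if l_ν = 0 then 1 else 0`); `theta_mem_Ico`; `exists_theta_ne_zero`.
* ★★ `gridDisplay_holds` — the hypothesis `hGrid` of `robustBound_of_gridDisplay` HOLDS with `C(d,n)`: dag-n07-w7 g6's
  `N07AliasSumRobustBound.aliasSum_robust_bound` at `ι = Fin d` and the angles `θ`, matched summand by summand (`phi1_periodic` ∕ `phi2_periodic` on the
  rotated coordinates, `B4Strip.Sxir_eq` for `S = 4n²sin²(·∕2n)`).
* ★★★ `robustBound` — (R1L) in x-space, unconditional: for every coarse `β` with `Σ_y β(y) = 0` and EVERY fine `r`,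
  `‖Σ_y conj β(y)·[(Δ⁻²r)(ny+c₀) − (Q′Δ⁻²r)(y)]‖ ≤ √C(d,n) · √(Σ_x ‖(Δ⁻¹Q′ᴴβ)(x)‖²) · √(Σ_x ‖r(x)‖²)`.

HONEST FRAMING (binding).  Count-neutral helper; re-indexing bookkeeping BY NAME over FILE 3 (`…OneLevelRobustBridge`) and dag-n07-w7 g6's p637570; the constant is crude and
`M`-independent (the located sharp values `C*(1,3) = 7.7e−4`, `C*(2,3) = 2.7e−3` are numerics, not typed); nothing of [B11]∕[B6]∕[B5]∕[3]'s analysis is asserted;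
(L4)'s (S3)–(S5) and `(P)_D` for Bałaban's d = 4 nested geometries stay OPEN; under road (a) of the K0 lineage nothing here is consumed — located-research insurance for
the R0′-native junction.  `hker` at the record ∕ stub 1 ∕ K0⁷ ∕ K1⁹ NOT closed; N07 NOT discharged; counts unmoved; no summit statement is proved by this seat — R4 closes
the conditional finite-𝕋⁴ rung `BalabanLadder.UV` only; nothing continuum ∕ ℝ⁴ ∕ OS ∕ mass gap ∕ Clay.  No `sorry`, no `def`, no `instance`, no `notation`.
-/

noncomputable section

open scoped BigOperators Matrix ComplexConjugate
open Finset Complex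

namespace Summit.QuantumFields.YangMills.BalabanUVNodes.N07PointFeasibilityOneLevelRobustBridge

open Literature.MathematicalPhysics.QuantumFieldTheory.Balaban1983to89
open B5Prop11Plancherel (Tor chi dft fine sOf)
open B5Block118 (bpt pOf iota QsOp)
open B5Prop11Fiber (uSym)
open B5LaplaceInverse (lsym LapSinv)

variable {d : ℕ} (n : ℕ) [NeZero n] (M : Fin d → ℕ) [hM : ∀ μ, NeZero (M μ)]

/-! ## §5  DISCHARGE: dag-n07-w7 g6's display `aliasSum_robust_bound` ⇒ the grid display ⇒ (R1L) in x-space, unconditionally (odd `n ≥ 3`) -/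

section Discharge

open Summit.QuantumFields.YangMills.Theorems.N07AliasSumRobustBound (aliasSum_robust_bound)

omit hM in
/-- **Re-indexing the signed representatives** (g2's `sum_reindex_gen` with the sign convention `s_κ < 0 ↦ s_κ + 2π` — so that `s_κ = 0 ↦ θ_κ = 0` — and a general
summand `Ψ(Π_κ F_κ, Σ_κ G_κ)`; periodicity `x ↦ x + 2πn` is only needed on the rotated coordinates `s_κ < 0`):
`Σ_{a∈[0,n)^J} Ψ(Π_κ F_κ(s_κ+2πa_κ), Σ_κ G_κ(s_κ+2πa_κ)) = Σ_m Ψ(Π_κ F_κ(θ_κ+2πm_κ), Σ_κ G_κ(θ_κ+2πm_κ))`. [folklore] -/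
theorem sum_reindex_neg {J : Type*} [Fintype J] [DecidableEq J] (hn : 0 < n) (s : J → ℝ) (Ψ : ℝ → ℝ → ℝ) (F G : J → ℝ → ℝ)
    (hF : ∀ κ, s κ < 0 → ∀ x, F κ (x + 2 * Real.pi * n) = F κ x) (hG : ∀ κ, s κ < 0 → ∀ x, G κ (x + 2 * Real.pi * n) = G κ x) :
    ∑ a : J → Fin n, Ψ (∏ κ, F κ (s κ + 2 * Real.pi * (a κ : ℕ))) (∑ κ, G κ (s κ + 2 * Real.pi * (a κ : ℕ)))
      = ∑ m : J → Fin n, Ψ (∏ κ, F κ ((if s κ < 0 then s κ + 2 * Real.pi else s κ) + 2 * Real.pi * (m κ : ℕ)))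
          (∑ κ, G κ ((if s κ < 0 then s κ + 2 * Real.pi else s κ) + 2 * Real.pi * (m κ : ℕ))) := by
  obtain ⟨n', rfl⟩ : ∃ n', n = n' + 1 := ⟨n - 1, by omega⟩
  let ρ : (J → Fin (n' + 1)) ≃ (J → Fin (n' + 1)) :=
    Equiv.piCongrRight fun κ => if s κ < 0 then finRotate (n' + 1) else Equiv.refl _
  rw [← ρ.sum_comp]
  refine Finset.sum_congr rfl fun m _ => ?_
  have key : ∀ κ, ∃ ε : ℕ, (ε = 0 ∨ (ε = 1 ∧ s κ < 0)) ∧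
      (s κ + 2 * Real.pi * ((ρ m κ : Fin (n' + 1)) : ℕ)) + 2 * Real.pi * (n' + 1 : ℕ) * ε
        = (if s κ < 0 then s κ + 2 * Real.pi else s κ) + 2 * Real.pi * (m κ : ℕ) := by
    intro κ
    by_cases hκ : s κ < 0
    · simp only [ρ, Equiv.piCongrRight_apply, Pi.map_apply, if_pos hκ, finRotate_apply, Fin.val_add_one]
      by_cases hlast : m κ = Fin.last n'
      · refine ⟨1, Or.inr ⟨rfl, hκ⟩, ?_⟩
        rw [if_pos hlast, hlast, Fin.val_last]
        push_cast
        ring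
      · refine ⟨0, Or.inl rfl, ?_⟩
        rw [if_neg hlast]
        push_cast
        ring
    · refine ⟨0, Or.inl rfl, ?_⟩
      simp [ρ, hκ]
  have hper : ∀ κ,
      F κ (s κ + 2 * Real.pi * ((ρ m κ : Fin (n' + 1)) : ℕ))
        = F κ ((if s κ < 0 then s κ + 2 * Real.pi else s κ) + 2 * Real.pi * (m κ : ℕ)) ∧
      G κ (s κ + 2 * Real.pi * ((ρ m κ : Fin (n' + 1)) : ℕ))
        = G κ ((if s κ < 0 then s κ + 2 * Real.pi else s κ) + 2 * Real.pi * (m κ : ℕ)) := by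
    intro κ
    obtain ⟨ε, hε, h⟩ := key κ
    rcases hε with rfl | ⟨rfl, hκ⟩
    · simp only [Nat.cast_zero, mul_zero, add_zero] at h
      rw [h]
      exact ⟨rfl, rfl⟩
    · rw [← h, Nat.cast_one, mul_one, hF κ hκ, hG κ hκ]
      exact ⟨rfl, rfl⟩
  congr 1
  · exact Finset.prod_congr rfl fun κ _ => (hper κ).1
  · exact Finset.sum_congr rfl fun κ _ => (hper κ).2

/-- The representatives `θ_ν := if s_ν < 0 then s_ν + 2π else s_ν` of `s = sOf M p′ ∈ [−π,π]^d` lie in `[0, 2π)`. [folklore] -/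
theorem theta_mem_Ico (q : Tor M) (ν : Fin d) :
    0 ≤ (if sOf M q ν < 0 then sOf M q ν + 2 * Real.pi else sOf M q ν) ∧
      (if sOf M q ν < 0 then sOf M q ν + 2 * Real.pi else sOf M q ν) < 2 * Real.pi := by
  have h1 := abs_le.mp (B5Prop11Plancherel.abs_sOf_le M q ν)
  have hπ := Real.pi_pos
  by_cases h : sOf M q ν < 0
  · rw [if_pos h]; constructor <;> linarith
  · rw [if_neg h]; constructor <;> linarith

/-- … and some `θ_ν ≠ 0` as soon as `p′ ≠ 0`. [folklore] -/
theorem exists_theta_ne_zero {q : Tor M} (hq : q ≠ 0) :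
    ∃ ν : Fin d, (if sOf M q ν < 0 then sOf M q ν + 2 * Real.pi else sOf M q ν) ≠ 0 := by
  obtain ⟨ν, hν⟩ := Function.ne_iff.mp hq
  refine ⟨ν, ?_⟩
  have hs : sOf M q ν ≠ 0 := fun h => hν ((N07PointFeasibilityOneLevel.sOf_apply_eq_zero_iff M q ν).mp h)
  have h1 := abs_le.mp (B5Prop11Plancherel.abs_sOf_le M q ν)
  have hπ := Real.pi_pos
  by_cases h : sOf M q ν < 0
  · rw [if_pos h]; linarith
  · rw [if_neg h]; exact hs

/-- ★★ **THE GRID DISPLAY HOLDS** (odd `n ≥ 3`): dag-n07-w7 g6's `aliasSum_robust_bound` at `ι = Fin d`, angles `θ_ν := if s_ν < 0 then s_ν + 2π else s_ν`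
(`s = sOf M p′`), re-indexed to the momentum grid `ϑ = s + 2πl` by `sum_reindex_neg` (the coordinates `p′_ν = 0` sit at `θ_ν = 0`, where `F(0,m) = δ_{m,0}`):
`Σ_l (1 − Π_ν F_ν)²((Σ_ν S_ν)⁻¹)⁴ ≤ C(d,n)·Σ_l (Π_ν F_ν)²((Σ_ν S_ν)⁻¹)²` with `C(d,n) = (π²∕4)^d(π⁴∕1024 + d²π⁴n^d∕64)`.
[cite: Balaban1984PropagatorsI, (1.29)-(1.33) p.23; Balaban1987RG1, (0.4) p.253] -/
theorem gridDisplay_holds (hn : Odd n) (h3 : 3 ≤ n) {q : Tor M} (hq : q ≠ 0) :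
    ∑ k : Fin d → Fin n, (1 - ∏ ν, (if q ν = 0 then (if k ν = 0 then (1 : ℝ) else 0) else
        Real.sin (B4Strip.shiftr n k (sOf M q) ν / 2) / ((n : ℝ) * Real.sin (B4Strip.shiftr n k (sOf M q) ν / (2 * n))))) ^ 2 *
        ((∑ ν, B4Strip.Sxir n (B4Strip.shiftr n k (sOf M q) ν))⁻¹) ^ 4
      ≤ ((Real.pi ^ 2 / 4) ^ d * (Real.pi ^ 4 / 1024 + (d : ℝ) ^ 2 * Real.pi ^ 4 * (n : ℝ) ^ d / 64)) *
        ∑ k : Fin d → Fin n, (∏ ν, (if q ν = 0 then (if k ν = 0 then (1 : ℝ) else 0) else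
        Real.sin (B4Strip.shiftr n k (sOf M q) ν / 2) / ((n : ℝ) * Real.sin (B4Strip.shiftr n k (sOf M q) ν / (2 * n))))) ^ 2 *
        ((∑ ν, B4Strip.Sxir n (B4Strip.shiftr n k (sOf M q) ν))⁻¹) ^ 2 := by
  classical
  have hn0 : n ≠ 0 := by omega
  have hnpos : 0 < n := by omega
  obtain ⟨s, hs⟩ : ∃ s : Fin d → ℝ, s = sOf M q := ⟨_, rfl⟩
  -- per-coordinate data as functions of the angle
  obtain ⟨F', hF'⟩ : ∃ F' : Fin d → ℝ → ℝ, F' = fun ν x => if q ν = 0 then (if x = 0 then (1 : ℝ) else 0) else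
      Real.sin (x / 2) / ((n : ℝ) * Real.sin (x / (2 * n))) := ⟨_, rfl⟩
  obtain ⟨G', hG'⟩ : ∃ G' : Fin d → ℝ → ℝ, G' = fun _ x => B4Strip.Sxir n x := ⟨_, rfl⟩
  -- the grid summands in these letters
  have hsz : ∀ ν, q ν = 0 → s ν = 0 := fun ν h => by rw [hs]; exact (N07PointFeasibilityOneLevel.sOf_apply_eq_zero_iff M q ν).mpr h
  have hfac : ∀ (k : Fin d → Fin n) ν,
      (if q ν = 0 then (if k ν = 0 then (1 : ℝ) else 0) else
        Real.sin (B4Strip.shiftr n k (sOf M q) ν / 2) / ((n : ℝ) * Real.sin (B4Strip.shiftr n k (sOf M q) ν / (2 * n))))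
        = F' ν (s ν + 2 * Real.pi * (k ν : ℕ)) := by
    intro k ν
    simp only [hF']
    by_cases hqν : q ν = 0
    · rw [if_pos hqν, if_pos hqν, hsz ν hqν, zero_add]
      have : (2 * Real.pi * ((k ν : ℕ) : ℝ) = 0) ↔ k ν = 0 := by
        rw [mul_eq_zero, Nat.cast_eq_zero, Fin.ext_iff, Fin.val_zero]
        exact ⟨fun h => h.resolve_left (by positivity), fun h => Or.inr h⟩
      by_cases hk : k ν = 0
      · rw [if_pos hk, if_pos (this.mpr hk)]
      · rw [if_neg hk, if_neg (fun h => hk (this.mp h))]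
    · rw [if_neg hqν, if_neg hqν, hs]; rfl
  have hG'' : ∀ (k : Fin d → Fin n), (∑ ν, B4Strip.Sxir n (B4Strip.shiftr n k (sOf M q) ν)) =
      ∑ ν, G' ν (s ν + 2 * Real.pi * ((k ν : ℕ) : ℝ)) := fun k => by rw [hG', hs]; rfl
  simp_rw [hfac, hG'']
  -- periodicity on the rotated coordinates (there `q ν ≠ 0`)
  have hFper : ∀ ν, s ν < 0 → ∀ x, F' ν (x + 2 * Real.pi * n) = F' ν x := by
    intro ν hν x
    have hqν : q ν ≠ 0 := fun h => by have := hsz ν h; linarith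
    simp only [hF', if_neg hqν]
    exact N07PointFeasibilityOneLevel.phi1_periodic hn x
  have hGper : ∀ ν : Fin d, s ν < 0 → ∀ x, G' ν (x + 2 * Real.pi * n) = G' ν x :=
    fun ν _ x => by simp only [hG']; exact N07PointFeasibilityOneLevel.phi2_periodic hn0 x
  rw [sum_reindex_neg n hnpos s (fun f g => (1 - f) ^ 2 * (g⁻¹) ^ 4) F' G' hFper hGper,
    sum_reindex_neg n hnpos s (fun f g => f ^ 2 * (g⁻¹) ^ 2) F' G' hFper hGper]
  -- dag-n07-w7 g6's display at these angles
  obtain ⟨θ, hθ⟩ : ∃ θ : Fin d → ℝ, θ = fun ν => if s ν < 0 then s ν + 2 * Real.pi else s ν := ⟨_, rfl⟩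
  have hθr : ∀ ν, 0 ≤ θ ν ∧ θ ν < 2 * Real.pi := fun ν => by rw [hθ, hs]; exact theta_mem_Ico M q ν
  have hne : ∃ ν, θ ν ≠ 0 := by rw [hθ, hs]; exact exists_theta_ne_zero M hq
  have hθapp : ∀ ν, (if s ν < 0 then s ν + 2 * Real.pi else s ν) = θ ν := fun ν => by rw [hθ]
  simp_rw [hθapp]
  have hw7 := aliasSum_robust_bound (ι := Fin d) hn h3 _ rfl _ rfl θ hθr hne
  simp only [Fintype.card_fin] at hw7
  -- match the summands
  have hθ0 : ∀ ν, q ν = 0 → θ ν = 0 := by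
    intro ν h; simp only [hθ, hsz ν h, lt_self_iff_false, if_false]
  have hθne : ∀ ν, q ν ≠ 0 → θ ν ≠ 0 := by
    intro ν hqν
    have hsν : s ν ≠ 0 := fun h => hqν ((N07PointFeasibilityOneLevel.sOf_apply_eq_zero_iff M q ν).mp (by rw [← hs]; exact h))
    have h1 := abs_le.mp (B5Prop11Plancherel.abs_sOf_le M q ν)
    rw [← hs] at h1
    have hπ := Real.pi_pos
    simp only [hθ]
    by_cases h : s ν < 0
    · rw [if_pos h]; linarith
    · rw [if_neg h]; exact hsν
  have hFmatch : ∀ (m : Fin d → Fin n) ν, F' ν (θ ν + 2 * Real.pi * ((m ν : ℕ) : ℝ)) =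
      (fun (θ : ℝ) (m : ℕ) => if θ = 0 then (if m = 0 then (1 : ℝ) else 0) else
        Real.sin ((θ + 2 * Real.pi * (m : ℝ)) / 2) / ((n : ℝ) * Real.sin ((θ + 2 * Real.pi * (m : ℝ)) / (2 * (n : ℝ))))) (θ ν) (m ν) := by
    intro m ν
    by_cases hqν : q ν = 0
    · simp only [hF', if_pos hqν, hθ0 ν hqν, if_true, zero_add]
      have : (2 * Real.pi * ((m ν : ℕ) : ℝ) = 0) ↔ ((m ν : ℕ) = 0) := by
        rw [mul_eq_zero, Nat.cast_eq_zero]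
        exact ⟨fun h => h.resolve_left (by positivity), fun h => Or.inr h⟩
      by_cases hm : (m ν : ℕ) = 0
      · rw [if_pos (this.mpr hm), if_pos hm]
      · rw [if_neg (fun h => hm (this.mp h)), if_neg hm]
    · simp only [hF', if_neg hqν, if_neg (hθne ν hqν)]
  have hGmatch : ∀ (m : Fin d → Fin n) ν, G' ν (θ ν + 2 * Real.pi * ((m ν : ℕ) : ℝ)) =
      (fun (θ : ℝ) (m : ℕ) => 4 * (n : ℝ) ^ 2 * Real.sin ((θ + 2 * Real.pi * (m : ℝ)) / (2 * (n : ℝ))) ^ 2) (θ ν) (m ν) := by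
    intro m ν
    simp only [hG']
    exact B4Strip.Sxir_eq n _
  simp_rw [hFmatch, hGmatch]
  -- `(g⁻¹)^k = 1∕g^k`
  have e4 : ∀ (a g : ℝ), a * (g⁻¹) ^ 4 = a / g ^ 4 := fun a g => by rw [inv_pow, div_eq_mul_inv]
  have e2 : ∀ (a g : ℝ), a * (g⁻¹) ^ 2 = a / g ^ 2 := fun a g => by rw [inv_pow, div_eq_mul_inv]
  simp_rw [e4, e2]
  exact hw7

/-- ★★★ **(R1L) IN x-SPACE, UNCONDITIONAL** (`n` odd, `3 ≤ n`, `n = 2c₀+1`, every `d`, every unit torus `M`): for every coarse `β` with `Σ_y β(y) = 0` and EVERY fine `r`,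
`‖Σ_y conj β(y)·[(Δ⁻²r)(ny+c₀) − (Q′Δ⁻²r)(y)]‖ ≤ √C(d,n) · √(Σ_x ‖(Δ⁻¹Q′ᴴβ)(x)‖²) · √(Σ_x ‖r(x)‖²)`, `C(d,n) = (π²∕4)^d(π⁴∕1024 + d²π⁴n^d∕64)` —
dag-n07-w7 g6's display `aliasSum_robust_bound` (p637570) ∘ §4 ∘ §3.  The constant is `M`-independent (crude; the located sharp values are `C* ≈ 10⁻³`).
[cite: Balaban1984PropagatorsI, (1.29)-(1.33) p.23; Balaban1984PropagatorsII, (2.22) p.226; Balaban1987RG1, (0.4) p.253] -/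
theorem robustBound (hn : Odd n) (h3 : 3 ≤ n) (c₀ : Fin d → Fin n) (hc₀ : ∀ ν, 2 * (c₀ ν : ℕ) + 1 = n)
    (β : Tor M → ℂ) (hβ : ∑ y, β y = 0) (r : Tor (fine n M) → ℂ) :
    ‖star β ⬝ᵥ (fun y => (LapSinv (fine n M) (n : ℂ) *ᵥ (LapSinv (fine n M) (n : ℂ) *ᵥ r)) (bpt n M y c₀) -
        (QsOp n M *ᵥ (LapSinv (fine n M) (n : ℂ) *ᵥ (LapSinv (fine n M) (n : ℂ) *ᵥ r))) y)‖
      ≤ Real.sqrt ((Real.pi ^ 2 / 4) ^ d * (Real.pi ^ 4 / 1024 + (d : ℝ) ^ 2 * Real.pi ^ 4 * (n : ℝ) ^ d / 64)) *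
          Real.sqrt (∑ x, ‖(LapSinv (fine n M) (n : ℂ) *ᵥ ((QsOp n M)ᴴ *ᵥ β)) x‖ ^ 2) * Real.sqrt (∑ x, ‖r x‖ ^ 2) :=
  robustBound_of_gridDisplay n M c₀ hc₀ (by positivity) (fun _ hq => gridDisplay_holds n M hn h3 hq) β hβ r

end Discharge


end Summit.QuantumFields.YangMills.BalabanUVNodes.N07PointFeasibilityOneLevelRobustBridge

end
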